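import Literature.MathematicalPhysics.QuantumFieldTheory.Balaban1983to89.B11Eq73KernelColumnsCarrier

/-!
# `Balaban1983to89.B11Eq73KernelColumnsTwoBackgrounds` — T. Bałaban, *The variational problem and background fields in renormalization group method for lattice gauge
# theories*, Commun. Math. Phys. **102** (1985) 277–309 [Balaban1985Variational] (63)–(73) pp. 287–289 («𝔇h = 𝒞′(X₀)h − ℜ(𝔇h)», (68)), (46) p. 285, (85)–(88) p. 291, Prop. 6
# (117)–(120) p. 295, with [Balaban1985BackgroundPropagators] Thm 3.4 p. 400: **THE KERNEL COLUMNS OF `(HD)′` AND OF THE COMPOSITE `N∘(HD)′` BETWEEN TWO CARRIERS (115)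
# (TWO BACKGROUNDS) THROUGH THE TWO-BACKGROUND ONE-BLOCK LETTERS OF `H`, OF `N∘H` AND THE TWO-BACKGROUND ENTRYWISE LETTER OF `𝒞′`** — from (68) on each carrier,
# `(HD)′₁ − (HD)′₂ = (H₁ − H₂)𝒞′₁(A₁)(1 − (HD)′₁) + H₂(𝒞′₁(A₁) − 𝒞′₂(A₂))(1 − (HD)′₁) − H₂𝒞′₂(A₂)((HD)′₁ − (HD)′₂)`, read entrywise through the majorants and summed
# (Neumann, window `(ε_C + a_C)Θ_HG ≤ ½` on both carriers): the letters `δθ_E` and `δθ′` of this lineage's `B11Eq98W80TwoBackgroundLetters` in terms of the weighted columns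
# `δΘ^r` of `δhk` (`‖(H₁δ_yZ)(b′) − (H₂δ_yZ)(b′)‖ ≤ δhk(b′,y)‖Z‖`), `δΘ′^r` of `δhk′` (the same for `N_i∘H_i`) and the column `δG` of `δg`
# (`‖(𝒞′₁(A₁)δ_bX)(y) − (𝒞′₂(A₂)δ_bX)(y)‖ ≤ δg(y,b)‖X‖` at the pair `A_i = T_iP_i`) — the two-background twin of this lineage's `B11Eq73KernelColumnsCarrier` (gen 97) ∕
# `B11Eq88KernelColumnsComposite` (gen 98), with NO operator norm and NO lattice count

statement-level skeleton of published theorems with citation tags; proofs where landed; nothing here is a claim about the Yang–Mills mass gap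

CITATION HEADER (lean-in-tree rule).  Audit cell `pub-balaban`, sub-cell `t4`, BINDER row NE9; filed by NE9 crux-team LEAF PROVER 01 (`b2b-balaban-t4-ne9-formalise-leaf-01`,
gen 105; ROUTE (J′), the `δ_W` brick; bears_on: R4/N22).  Composition BY NAME: this lineage's `B11Eq73KernelColumnsCarrier.{negSup_sum_single, flat_apply_eq_sum_single,
negSup_apply_eq_sum_single, fderiv_Emap_eq, colSum_kernel_fderiv_Emap_le}`; ne9-leaf-05's `B11Eq90Transpose.{kernel, single115}`, `B11Eq90V0GroupComposed.{T47, norm_T47_lt, norm_T47_le}`.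
Source READ first-hand in the held text layer `paper:balaban1985-cmp102-variational-background` (journal page = PDF page + 276) pp. 287–291.  NOTHING of print's proofs is
reproduced: [folklore] majorant algebra for (68) at two carriers.

WHAT IS PROVED (sorry-free; proof lane — 0 `def`; [folklore]).  §1 `norm_gvec_apply_le`, `norm_gvec_sub_apply_le` (the one-block pieces of `g_i = 𝒞′_i(A_i)(1 − (HD)′_i)δ_bX` and of
`g₁ − g₂`); §2 **`opNorm_kernel_sub_le`** (entrywise majorant inequality for `u(b′, b) = ‖k_{(HD)′₁(P₁)}(b′, b) − k_{(HD)′₂(P₂)}(b′, b)‖`), `colSum_weight_kernel_sub_le`,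
**`colSum_kernel_sub_le`** (`Σ_{b′}u(b′, b) ≤ 4((ε_C + a_C)δΘG₁ + Θ_{H,2}δG)`), **`colSum_weighted_kernel_sub_le`** (the letter `δθ_E`); §3 `norm_equiv_comp_kernel_sub_apply_le`,
**`colSum_weighted_comp_kernel_sub_le`** (the letter `δθ′`).
HONEST SCOPE.  Mechanism only: every letter is DISPLAYED (lattice-free suppliers: gen 101's two-background ladder of `H̃_{1,k}` `B9Eq3133H1kPiTwoBackgroundLetterTower`, the composite
current's and `C_k`'s two-background letters — this lineage's next files); nothing of [B11] (63)–(73) ∕ Prop. 6 or [B9] Thm 3.4 asserted as printed; «NE9 ⇐ the named binders»;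
NE9 NOT PRINTED ∕ NOT PROVED; spine PROVED 0∕9; rung (B)+1 finite T⁴ — NOT infinite volume, NOT mass gap, NOT BetaPertH, NOT Clay.  HONEST DEPENDENCY: continuum YM on T⁴ ⇐
BetaPertH ∧ nine spine estimates (0/9 proved); BetaPertH ⇐ (D1) ∧ (D4) ∧ CAP+tail; G-an2-4 gates asym, D1 and NE2/3/4.  NEW file; nothing modified.  Net new unproved facts: 0.
-/

noncomputable section

open scoped BigOperators
open Finset Metric Set Filter Topology

namespace Literature.MathematicalPhysics.QuantumFieldTheory.Balaban1983to89.B11Eq73KernelColumnsTwoBackgrounds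

open Literature.MathematicalPhysics.QuantumFieldTheory.Balaban1983to89.B11Prop6Scheme (Prop4Hyp)
open Literature.MathematicalPhysics.QuantumFieldTheory.Balaban1983to89.B11Eq174Chart (solA Regime)
open Literature.MathematicalPhysics.QuantumFieldTheory.Balaban1983to89.B11Eq90Transpose (kernel kernel_apply single115 sum_single115 flat115_single115)
open Literature.MathematicalPhysics.QuantumFieldTheory.Balaban1983to89.B11Eq90V0primeCurrent (flat115 flat115_apply)
open Literature.MathematicalPhysics.QuantumFieldTheory.Balaban1983to89.B11Eq90V0GroupComposed (T47 T47_apply norm_T47_le norm_T47_lt)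
open Literature.MathematicalPhysics.QuantumFieldTheory.Balaban1983to89.B11Eq80Current (Emap Emap_eq_H)
open Literature.MathematicalPhysics.QuantumFieldTheory.Balaban1983to89.B11Eq73KernelColumnsCarrier (negSup_sum_single flat_apply_eq_sum_single
  negSup_apply_eq_sum_single fderiv_Emap_eq colSum_kernel_fderiv_Emap_le)
open B9SectCLatticeCarrier (Bond)
open B11Eq115Space

variable {𝔸 : Type*} [NormedRing 𝔸] [NormedAlgebra ℂ 𝔸] [FiniteDimensional ℂ 𝔸]
variable {d : ℕ} {Pd : Fin d → ℕ} {L η : ℝ} [Fact (0 < L)] [Fact (0 < η)] {lev₀ : Bond d Pd → ℕ} {κ' : Type*} [Fintype κ']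
  {lev₁ : κ' → ℕ} {Dc₁ Dc₂ : (Bond d Pd → 𝔸) →ₗ[ℂ] (κ' → 𝔸)}
variable {β : Type*} [Fintype β] [DecidableEq β] {wB : β → ℝ} [Fact (∀ y, 0 < wB y)]
variable {γ : Type*} [Fintype γ] {w' : γ → ℝ} [Fact (∀ i, 0 < w' i)]

variable {H₁ : NegSup wB 𝔸 →L[ℂ] Space115 L η lev₀ lev₁ Dc₁} {C₁ : Space115 L η lev₀ lev₁ Dc₁ → NegSup wB 𝔸}
  {H₂ : NegSup wB 𝔸 →L[ℂ] Space115 L η lev₀ lev₁ Dc₂} {C₂' : Space115 L η lev₀ lev₁ Dc₂ → NegSup wB 𝔸} {b C₂ c₄ aC εC : ℝ}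
  (RC₁ : Regime H₁ 0 C₁ b 0 C₂ c₄ 0 aC εC) (hC₁ : Prop4Hyp C₁ C₂ c₄) (RC₂ : Regime H₂ 0 C₂' b 0 C₂ c₄ 0 aC εC) (hC₂ : Prop4Hyp C₂' C₂ c₄)
  -- the one-background letters of carrier 1: the one-block letter of `H₁`, its plain fine column, the entrywise letter of `𝒞′₁`, its coarse column, the window
  {hk₁ : Bond d Pd → β → ℝ} (hk₁0 : ∀ b' y, 0 ≤ hk₁ b' y)
  (hHk₁ : ∀ (y : β) (Z : 𝔸) (b' : Bond d Pd), ‖flat115 (H₁ ((NegSup.equiv wB 𝔸).symm (Pi.single y Z))) b'‖ ≤ hk₁ b' y * ‖Z‖)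
  {ΘH₁ : ℝ} (hH1₁ : ∀ y, ∑ b', hk₁ b' y ≤ ΘH₁)
  {gC₁ : β → Bond d Pd → ℝ} (hgC₁0 : ∀ y bb, 0 ≤ gC₁ y bb)
  (hCg₁ : ∀ A : Space115 L η lev₀ lev₁ Dc₁, ‖A‖ < εC + aC → ∀ (bb : Bond d Pd) (X : 𝔸) (y : β),
      ‖NegSup.equiv wB 𝔸 (fderiv ℂ C₁ A (single115 (lev₁ := lev₁) (Dc := Dc₁) bb X)) y‖ ≤ gC₁ y bb * ‖A‖ * ‖X‖)
  {G₁ : ℝ} (hG₁ : ∀ bb, ∑ y, gC₁ y bb ≤ G₁) (hq₁ : (εC + aC) * ΘH₁ * G₁ ≤ 1 / 2)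
  -- the one-background letters of carrier 2
  {hk₂ : Bond d Pd → β → ℝ} (hk₂0 : ∀ b' y, 0 ≤ hk₂ b' y)
  (hHk₂ : ∀ (y : β) (Z : 𝔸) (b' : Bond d Pd), ‖flat115 (H₂ ((NegSup.equiv wB 𝔸).symm (Pi.single y Z))) b'‖ ≤ hk₂ b' y * ‖Z‖)
  {ΘH₂ : ℝ} (hH1₂ : ∀ y, ∑ b', hk₂ b' y ≤ ΘH₂)
  {gC₂ : β → Bond d Pd → ℝ} (hgC₂0 : ∀ y bb, 0 ≤ gC₂ y bb)
  (hCg₂ : ∀ A : Space115 L η lev₀ lev₁ Dc₂, ‖A‖ < εC + aC → ∀ (bb : Bond d Pd) (X : 𝔸) (y : β),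
      ‖NegSup.equiv wB 𝔸 (fderiv ℂ C₂' A (single115 (lev₁ := lev₁) (Dc := Dc₂) bb X)) y‖ ≤ gC₂ y bb * ‖A‖ * ‖X‖)
  {G₂ : ℝ} (hG₂ : ∀ bb, ∑ y, gC₂ y bb ≤ G₂) (hq₂ : (εC + aC) * ΘH₂ * G₂ ≤ 1 / 2)
  -- the pair of configurations and the two-background letters: `δhk` of `H₁ − H₂`, `δg` of `𝒞′₁(A₁) − 𝒞′₂(A₂)`
  {P₁ : Space115 L η lev₀ lev₁ Dc₁} {P₂ : Space115 L η lev₀ lev₁ Dc₂} (hP₁ : ‖P₁‖ < aC) (hP₂ : ‖P₂‖ < aC)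
  {δhk : Bond d Pd → β → ℝ} (hδhk0 : ∀ b' y, 0 ≤ δhk b' y)
  (hδH : ∀ (y : β) (Z : 𝔸) (b' : Bond d Pd), ‖flat115 (H₁ ((NegSup.equiv wB 𝔸).symm (Pi.single y Z))) b' -
    flat115 (H₂ ((NegSup.equiv wB 𝔸).symm (Pi.single y Z))) b'‖ ≤ δhk b' y * ‖Z‖)
  {δg : β → Bond d Pd → ℝ} (hδg0 : ∀ y bb, 0 ≤ δg y bb)
  (hδg : ∀ (bb : Bond d Pd) (X : 𝔸) (y : β), ‖NegSup.equiv wB 𝔸 (fderiv ℂ C₁ (T47 H₁ C₁ εC P₁) (single115 (lev₁ := lev₁) (Dc := Dc₁) bb X)) y -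
    NegSup.equiv wB 𝔸 (fderiv ℂ C₂' (T47 H₂ C₂' εC P₂) (single115 (lev₁ := lev₁) (Dc := Dc₂) bb X)) y‖ ≤ δg y bb * ‖X‖)
  {δG : ℝ} (hδG : ∀ bb, ∑ y, δg y bb ≤ δG)

/-! ## §1 The one-block pieces of `g_i = 𝒞′_i(A_i)(δ_bX − (HD)′_i δ_bX)` and of their difference -/

omit [DecidableEq β] in
include RC₁ hgC₁0 hCg₁ hP₁ in
/-- **The one-block pieces of `g₁ = 𝒞′₁(A₁)(1 − (HD)′₁)δ_bX`**: `‖g₁(y)‖ ≤ ‖A₁‖·(g₁(y, b) + Σ_{b″} g₁(y, b″)u₁(b″, b))·‖X‖`, `u₁(b″, b) = ‖k_{(HD)′₁}(b″, b)‖` (the majorant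
of (68)–(69), as in `B11Eq73KernelColumnsCarrier.opNorm_kernel_fderiv_Emap_le`). [cite: Balaban1985Variational, (68)–(69) p.288, (63) p.287] -/
theorem norm_gvec_apply_le (bb : Bond d Pd) (X : 𝔸) (y : β) :
    ‖NegSup.equiv wB 𝔸 (fderiv ℂ C₁ (T47 H₁ C₁ εC P₁) (single115 (lev₁ := lev₁) (Dc := Dc₁) bb X -
        fderiv ℂ (Emap H₁ C₁ εC) P₁ (single115 (lev₁ := lev₁) (Dc := Dc₁) bb X))) y‖ ≤
      ‖T47 H₁ C₁ εC P₁‖ * (gC₁ y bb + ∑ b'', gC₁ y b'' * ‖kernel (fderiv ℂ (Emap H₁ C₁ εC) P₁) b'' bb‖) * ‖X‖ := by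
  have hAlt : ‖T47 H₁ C₁ εC P₁‖ < εC + aC := norm_T47_lt RC₁ hP₁
  rw [map_sub, NegSup.equiv_sub, Pi.sub_apply]
  have h1 := hCg₁ _ hAlt bb X y
  have h2 : ‖NegSup.equiv wB 𝔸 (fderiv ℂ C₁ (T47 H₁ C₁ εC P₁) (fderiv ℂ (Emap H₁ C₁ εC) P₁ (single115 (lev₁ := lev₁) (Dc := Dc₁) bb X))) y‖ ≤
      ∑ b'', gC₁ y b'' * ‖T47 H₁ C₁ εC P₁‖ * (‖kernel (fderiv ℂ (Emap H₁ C₁ εC) P₁) b'' bb‖ * ‖X‖) := by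
    rw [negSup_apply_eq_sum_single]
    refine (norm_sum_le _ _).trans (Finset.sum_le_sum fun b'' _ => ?_)
    refine (hCg₁ _ hAlt b'' _ y).trans (mul_le_mul_of_nonneg_left ?_ (mul_nonneg (hgC₁0 _ _) (norm_nonneg _)))
    rw [← kernel_apply]
    exact (kernel (fderiv ℂ (Emap H₁ C₁ εC) P₁) b'' bb).le_opNorm X
  calc _ ≤ ‖NegSup.equiv wB 𝔸 (fderiv ℂ C₁ (T47 H₁ C₁ εC P₁) (single115 (lev₁ := lev₁) (Dc := Dc₁) bb X)) y‖ +
        ‖NegSup.equiv wB 𝔸 (fderiv ℂ C₁ (T47 H₁ C₁ εC P₁) (fderiv ℂ (Emap H₁ C₁ εC) P₁ (single115 (lev₁ := lev₁) (Dc := Dc₁) bb X))) y‖ := norm_sub_le _ _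
    _ ≤ gC₁ y bb * ‖T47 H₁ C₁ εC P₁‖ * ‖X‖ +
        ∑ b'', gC₁ y b'' * ‖T47 H₁ C₁ εC P₁‖ * (‖kernel (fderiv ℂ (Emap H₁ C₁ εC) P₁) b'' bb‖ * ‖X‖) := add_le_add h1 h2
    _ = _ := by
        rw [mul_add, add_mul, Finset.mul_sum, Finset.sum_mul]
        congr 1
        · ring
        · exact Finset.sum_congr rfl fun _ _ => by ring

omit [DecidableEq β] in
include RC₂ hgC₂0 hCg₂ hP₂ hδg0 hδg in
/-- **The one-block pieces of `g₁ − g₂`**: `g₁ − g₂ = (𝒞′₁δ¹_bX − 𝒞′₂δ²_bX) − Σ_{b″}(𝒞′₁δ¹_{b″} − 𝒞′₂δ²_{b″})(k₁(b″,b)X) − Σ_{b″}𝒞′₂δ²_{b″}((k₁ − k₂)(b″,b)X)`, so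
`‖(g₁ − g₂)(y)‖ ≤ (δg(y,b) + Σ_{b″}δg(y,b″)u₁(b″,b) + ‖A₂‖Σ_{b″}g₂(y,b″)u(b″,b))·‖X‖`, `u = ‖k₁ − k₂‖`. [cite: Balaban1985Variational, (68)–(69) p.288, Prop. 6 (117)–(119) p.295] -/
theorem norm_gvec_sub_apply_le (bb : Bond d Pd) (X : 𝔸) (y : β) :
    ‖NegSup.equiv wB 𝔸 (fderiv ℂ C₁ (T47 H₁ C₁ εC P₁) (single115 (lev₁ := lev₁) (Dc := Dc₁) bb X -
        fderiv ℂ (Emap H₁ C₁ εC) P₁ (single115 (lev₁ := lev₁) (Dc := Dc₁) bb X))) y -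
      NegSup.equiv wB 𝔸 (fderiv ℂ C₂' (T47 H₂ C₂' εC P₂) (single115 (lev₁ := lev₁) (Dc := Dc₂) bb X -
        fderiv ℂ (Emap H₂ C₂' εC) P₂ (single115 (lev₁ := lev₁) (Dc := Dc₂) bb X))) y‖ ≤
      (δg y bb + ∑ b'', δg y b'' * ‖kernel (fderiv ℂ (Emap H₁ C₁ εC) P₁) b'' bb‖ +
        ‖T47 H₂ C₂' εC P₂‖ * ∑ b'', gC₂ y b'' * ‖kernel (fderiv ℂ (Emap H₁ C₁ εC) P₁) b'' bb - kernel (fderiv ℂ (Emap H₂ C₂' εC) P₂) b'' bb‖) * ‖X‖ := by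
  have hAlt : ‖T47 H₂ C₂' εC P₂‖ < εC + aC := norm_T47_lt RC₂ hP₂
  set K₁ := fderiv ℂ (Emap H₁ C₁ εC) P₁ with hK₁
  set K₂ := fderiv ℂ (Emap H₂ C₂' εC) P₂ with hK₂
  set D₁ := fderiv ℂ C₁ (T47 H₁ C₁ εC P₁) with hD₁
  set D₂ := fderiv ℂ C₂' (T47 H₂ C₂' εC P₂) with hD₂
  -- the `K`-terms decomposed over the fine bonds `b″`
  have e₁ : NegSup.equiv wB 𝔸 (D₁ (K₁ (single115 (lev₁ := lev₁) (Dc := Dc₁) bb X))) y =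
      ∑ b'', NegSup.equiv wB 𝔸 (D₁ (single115 (lev₁ := lev₁) (Dc := Dc₁) b'' (kernel K₁ b'' bb X))) y := by
    rw [negSup_apply_eq_sum_single]; rfl
  have e₂ : NegSup.equiv wB 𝔸 (D₂ (K₂ (single115 (lev₁ := lev₁) (Dc := Dc₂) bb X))) y =
      ∑ b'', NegSup.equiv wB 𝔸 (D₂ (single115 (lev₁ := lev₁) (Dc := Dc₂) b'' (kernel K₂ b'' bb X))) y := by
    rw [negSup_apply_eq_sum_single]; rfl
  have e₃ : ∑ b'', NegSup.equiv wB 𝔸 (D₂ (single115 (lev₁ := lev₁) (Dc := Dc₂) b'' (kernel K₂ b'' bb X))) y =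
      ∑ b'', NegSup.equiv wB 𝔸 (D₂ (single115 (lev₁ := lev₁) (Dc := Dc₂) b'' (kernel K₁ b'' bb X))) y -
        ∑ b'', NegSup.equiv wB 𝔸 (D₂ (single115 (lev₁ := lev₁) (Dc := Dc₂) b'' ((kernel K₁ b'' bb - kernel K₂ b'' bb) X))) y := by
    rw [← Finset.sum_sub_distrib]
    refine Finset.sum_congr rfl fun b'' _ => ?_
    rw [sub_apply, map_sub, map_sub, NegSup.equiv_sub, Pi.sub_apply, sub_sub_cancel]
  have eD₁ : NegSup.equiv wB 𝔸 (D₁ (single115 (lev₁ := lev₁) (Dc := Dc₁) bb X - K₁ (single115 (lev₁ := lev₁) (Dc := Dc₁) bb X))) y =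
      NegSup.equiv wB 𝔸 (D₁ (single115 (lev₁ := lev₁) (Dc := Dc₁) bb X)) y - NegSup.equiv wB 𝔸 (D₁ (K₁ (single115 (lev₁ := lev₁) (Dc := Dc₁) bb X))) y := by
    rw [map_sub, NegSup.equiv_sub, Pi.sub_apply]
  have eD₂ : NegSup.equiv wB 𝔸 (D₂ (single115 (lev₁ := lev₁) (Dc := Dc₂) bb X - K₂ (single115 (lev₁ := lev₁) (Dc := Dc₂) bb X))) y =
      NegSup.equiv wB 𝔸 (D₂ (single115 (lev₁ := lev₁) (Dc := Dc₂) bb X)) y - NegSup.equiv wB 𝔸 (D₂ (K₂ (single115 (lev₁ := lev₁) (Dc := Dc₂) bb X))) y := by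
    rw [map_sub, NegSup.equiv_sub, Pi.sub_apply]
  have e : NegSup.equiv wB 𝔸 (D₁ (single115 (lev₁ := lev₁) (Dc := Dc₁) bb X - K₁ (single115 (lev₁ := lev₁) (Dc := Dc₁) bb X))) y -
      NegSup.equiv wB 𝔸 (D₂ (single115 (lev₁ := lev₁) (Dc := Dc₂) bb X - K₂ (single115 (lev₁ := lev₁) (Dc := Dc₂) bb X))) y =
      (NegSup.equiv wB 𝔸 (D₁ (single115 (lev₁ := lev₁) (Dc := Dc₁) bb X)) y - NegSup.equiv wB 𝔸 (D₂ (single115 (lev₁ := lev₁) (Dc := Dc₂) bb X)) y) -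
        ∑ b'', (NegSup.equiv wB 𝔸 (D₁ (single115 (lev₁ := lev₁) (Dc := Dc₁) b'' (kernel K₁ b'' bb X))) y -
          NegSup.equiv wB 𝔸 (D₂ (single115 (lev₁ := lev₁) (Dc := Dc₂) b'' (kernel K₁ b'' bb X))) y) -
        ∑ b'', NegSup.equiv wB 𝔸 (D₂ (single115 (lev₁ := lev₁) (Dc := Dc₂) b'' ((kernel K₁ b'' bb - kernel K₂ b'' bb) X))) y := by
    rw [eD₁, eD₂, e₁, e₂, e₃, Finset.sum_sub_distrib]
    abel
  rw [e]
  have h0 := hδg bb X y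
  have h1 : ‖∑ b'', (NegSup.equiv wB 𝔸 (D₁ (single115 (lev₁ := lev₁) (Dc := Dc₁) b'' (kernel K₁ b'' bb X))) y -
      NegSup.equiv wB 𝔸 (D₂ (single115 (lev₁ := lev₁) (Dc := Dc₂) b'' (kernel K₁ b'' bb X))) y)‖ ≤ ∑ b'', δg y b'' * (‖kernel K₁ b'' bb‖ * ‖X‖) := by
    refine (norm_sum_le _ _).trans (Finset.sum_le_sum fun b'' _ => ?_)
    exact (hδg b'' _ y).trans (mul_le_mul_of_nonneg_left ((kernel K₁ b'' bb).le_opNorm X) (hδg0 _ _))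
  have h2 : ‖∑ b'', NegSup.equiv wB 𝔸 (D₂ (single115 (lev₁ := lev₁) (Dc := Dc₂) b'' ((kernel K₁ b'' bb - kernel K₂ b'' bb) X))) y‖ ≤
      ∑ b'', gC₂ y b'' * ‖T47 H₂ C₂' εC P₂‖ * (‖kernel K₁ b'' bb - kernel K₂ b'' bb‖ * ‖X‖) := by
    refine (norm_sum_le _ _).trans (Finset.sum_le_sum fun b'' _ => ?_)
    exact (hCg₂ _ hAlt b'' _ y).trans (mul_le_mul_of_nonneg_left ((kernel K₁ b'' bb - kernel K₂ b'' bb).le_opNorm X)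
      (mul_nonneg (hgC₂0 _ _) (norm_nonneg _)))
  calc _ ≤ ‖NegSup.equiv wB 𝔸 (D₁ (single115 (lev₁ := lev₁) (Dc := Dc₁) bb X)) y - NegSup.equiv wB 𝔸 (D₂ (single115 (lev₁ := lev₁) (Dc := Dc₂) bb X)) y‖ +
        ‖∑ b'', (NegSup.equiv wB 𝔸 (D₁ (single115 (lev₁ := lev₁) (Dc := Dc₁) b'' (kernel K₁ b'' bb X))) y -
          NegSup.equiv wB 𝔸 (D₂ (single115 (lev₁ := lev₁) (Dc := Dc₂) b'' (kernel K₁ b'' bb X))) y)‖ +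
        ‖∑ b'', NegSup.equiv wB 𝔸 (D₂ (single115 (lev₁ := lev₁) (Dc := Dc₂) b'' ((kernel K₁ b'' bb - kernel K₂ b'' bb) X))) y‖ :=
        (norm_sub_le _ _).trans (add_le_add (norm_sub_le _ _) le_rfl)
    _ ≤ δg y bb * ‖X‖ + ∑ b'', δg y b'' * (‖kernel K₁ b'' bb‖ * ‖X‖) +
        ∑ b'', gC₂ y b'' * ‖T47 H₂ C₂' εC P₂‖ * (‖kernel K₁ b'' bb - kernel K₂ b'' bb‖ * ‖X‖) := add_le_add (add_le_add h0 h1) h2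
    _ = _ := by
        rw [add_mul, add_mul, Finset.sum_mul, Finset.mul_sum, Finset.sum_mul]
        congr 1
        · congr 1; exact Finset.sum_congr rfl fun _ _ => by ring
        · exact Finset.sum_congr rfl fun _ _ => by ring

/-! ## §2 The kernel columns of `(HD)′₁(P₁) − (HD)′₂(P₂)`: the letter `δθ_E` -/

include RC₁ hC₁ RC₂ hC₂ hgC₁0 hCg₁ hk₂0 hHk₂ hgC₂0 hCg₂ hP₁ hP₂ hδhk0 hδH hδg0 hδg in
/-- **THE ENTRYWISE MAJORANT INEQUALITY FOR THE KERNEL DIFFERENCE** `u(b′, b) = ‖k_{(HD)′₁(P₁)}(b′, b) − k_{(HD)′₂(P₂)}(b′, b)‖`: from (68) on both carriers,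
`k₁X − k₂X = ((H₁ − H₂)g₁)(b′) + (H₂(g₁ − g₂))(b′)`, hence `u(b′,b) ≤ ‖A₁‖Σ_y δhk(b′,y)T₁(y) + Σ_y hk₂(b′,y)(D(y) + ‖A₂‖Σ_{b″}g₂(y,b″)u(b″,b))` with
`T₁(y) = g₁(y,b) + Σ_{b″}g₁(y,b″)u₁(b″,b)`, `D(y) = δg(y,b) + Σ_{b″}δg(y,b″)u₁(b″,b)`. [cite: Balaban1985Variational, (68)–(69) p.288, (63) p.287, Prop. 6 (117) p.295] -/
theorem opNorm_kernel_sub_le (b' bb : Bond d Pd) :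
    ‖kernel (fderiv ℂ (Emap H₁ C₁ εC) P₁) b' bb - kernel (fderiv ℂ (Emap H₂ C₂' εC) P₂) b' bb‖ ≤
      ‖T47 H₁ C₁ εC P₁‖ * ∑ y, δhk b' y * (gC₁ y bb + ∑ b'', gC₁ y b'' * ‖kernel (fderiv ℂ (Emap H₁ C₁ εC) P₁) b'' bb‖) +
      ∑ y, hk₂ b' y * ((δg y bb + ∑ b'', δg y b'' * ‖kernel (fderiv ℂ (Emap H₁ C₁ εC) P₁) b'' bb‖) +
        ‖T47 H₂ C₂' εC P₂‖ * ∑ b'', gC₂ y b'' * ‖kernel (fderiv ℂ (Emap H₁ C₁ εC) P₁) b'' bb - kernel (fderiv ℂ (Emap H₂ C₂' εC) P₂) b'' bb‖) := by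
  set K₁ := fderiv ℂ (Emap H₁ C₁ εC) P₁ with hK₁
  set K₂ := fderiv ℂ (Emap H₂ C₂' εC) P₂ with hK₂
  set T₁ : β → ℝ := fun y => gC₁ y bb + ∑ b'', gC₁ y b'' * ‖kernel K₁ b'' bb‖ with hT₁
  set D : β → ℝ := fun y => (δg y bb + ∑ b'', δg y b'' * ‖kernel K₁ b'' bb‖) +
    ‖T47 H₂ C₂' εC P₂‖ * ∑ b'', gC₂ y b'' * ‖kernel K₁ b'' bb - kernel K₂ b'' bb‖ with hD
  have hT₁0 : ∀ y, 0 ≤ T₁ y := fun y => add_nonneg (hgC₁0 _ _) (Finset.sum_nonneg fun _ _ => mul_nonneg (hgC₁0 _ _) (norm_nonneg _))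
  have hD0 : ∀ y, 0 ≤ D y := fun y => add_nonneg (add_nonneg (hδg0 _ _) (Finset.sum_nonneg fun _ _ => mul_nonneg (hδg0 _ _) (norm_nonneg _)))
    (mul_nonneg (norm_nonneg (T47 H₂ C₂' εC P₂)) (Finset.sum_nonneg fun _ _ => mul_nonneg (hgC₂0 _ _) (norm_nonneg _)))
  have hrhs : 0 ≤ ‖T47 H₁ C₁ εC P₁‖ * ∑ y, δhk b' y * T₁ y + ∑ y, hk₂ b' y * D y :=
    add_nonneg (mul_nonneg (norm_nonneg _) (Finset.sum_nonneg fun y _ => mul_nonneg (hδhk0 _ _) (hT₁0 y)))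
      (Finset.sum_nonneg fun y _ => mul_nonneg (hk₂0 _ _) (hD0 y))
  refine ContinuousLinearMap.opNorm_le_bound _ hrhs fun X => ?_
  -- (68) on both carriers: `K_i δ_b X = H_i g_i`
  set g₁ : NegSup wB 𝔸 := fderiv ℂ C₁ (T47 H₁ C₁ εC P₁) (single115 (lev₁ := lev₁) (Dc := Dc₁) bb X - K₁ (single115 (lev₁ := lev₁) (Dc := Dc₁) bb X)) with hg₁
  set g₂ : NegSup wB 𝔸 := fderiv ℂ C₂' (T47 H₂ C₂' εC P₂) (single115 (lev₁ := lev₁) (Dc := Dc₂) bb X - K₂ (single115 (lev₁ := lev₁) (Dc := Dc₂) bb X)) with hg₂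
  have hKX₁ : K₁ (single115 (lev₁ := lev₁) (Dc := Dc₁) bb X) = H₁ g₁ := by
    conv_lhs => rw [hK₁, fderiv_Emap_eq RC₁ hC₁ hP₁]
    rfl
  have hKX₂ : K₂ (single115 (lev₁ := lev₁) (Dc := Dc₂) bb X) = H₂ g₂ := by
    conv_lhs => rw [hK₂, fderiv_Emap_eq RC₂ hC₂ hP₂]
    rfl
  have hgy : ∀ y, ‖NegSup.equiv wB 𝔸 g₁ y‖ ≤ ‖T47 H₁ C₁ εC P₁‖ * T₁ y * ‖X‖ := fun y =>
    norm_gvec_apply_le RC₁ hgC₁0 hCg₁ hP₁ bb X y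
  have hgdy : ∀ y, ‖NegSup.equiv wB 𝔸 g₁ y - NegSup.equiv wB 𝔸 g₂ y‖ ≤ D y * ‖X‖ := fun y =>
    norm_gvec_sub_apply_le RC₂ hgC₂0 hCg₂ hP₂ hδg0 hδg bb X y
  -- `k₁X − k₂X = Σ_y [(H₁ − H₂)δ_y g₁(y)](b′) + Σ_y [H₂ δ_y (g₁ − g₂)(y)](b′)`
  have e0 : (kernel K₁ b' bb - kernel K₂ b' bb) X = (flat115 (H₁ g₁) b' - flat115 (H₂ g₁) b') + flat115 (H₂ (g₁ - g₂)) b' := by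
    rw [sub_apply, kernel_apply, kernel_apply, hKX₁, hKX₂, map_sub, map_sub, Pi.sub_apply]; abel
  have e : (kernel K₁ b' bb - kernel K₂ b' bb) X =
      ∑ y, (flat115 (H₁ ((NegSup.equiv wB 𝔸).symm (Pi.single y (NegSup.equiv wB 𝔸 g₁ y)))) b' -
        flat115 (H₂ ((NegSup.equiv wB 𝔸).symm (Pi.single y (NegSup.equiv wB 𝔸 g₁ y)))) b') +
      ∑ y, flat115 (H₂ ((NegSup.equiv wB 𝔸).symm (Pi.single y (NegSup.equiv wB 𝔸 (g₁ - g₂) y)))) b' := by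
    rw [e0, flat_apply_eq_sum_single H₁ g₁ b', flat_apply_eq_sum_single H₂ g₁ b', flat_apply_eq_sum_single H₂ (g₁ - g₂) b',
      ← Finset.sum_sub_distrib]
  rw [e]
  calc _ ≤ ‖∑ y, (flat115 (H₁ ((NegSup.equiv wB 𝔸).symm (Pi.single y (NegSup.equiv wB 𝔸 g₁ y)))) b' -
          flat115 (H₂ ((NegSup.equiv wB 𝔸).symm (Pi.single y (NegSup.equiv wB 𝔸 g₁ y)))) b')‖ +
        ‖∑ y, flat115 (H₂ ((NegSup.equiv wB 𝔸).symm (Pi.single y (NegSup.equiv wB 𝔸 (g₁ - g₂) y)))) b'‖ := norm_add_le _ _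
    _ ≤ ∑ y, δhk b' y * ‖NegSup.equiv wB 𝔸 g₁ y‖ + ∑ y, hk₂ b' y * ‖NegSup.equiv wB 𝔸 (g₁ - g₂) y‖ :=
        add_le_add ((norm_sum_le _ _).trans (Finset.sum_le_sum fun y _ => hδH y _ b'))
          ((norm_sum_le _ _).trans (Finset.sum_le_sum fun y _ => hHk₂ y _ b'))
    _ ≤ ∑ y, δhk b' y * (‖T47 H₁ C₁ εC P₁‖ * T₁ y * ‖X‖) + ∑ y, hk₂ b' y * (D y * ‖X‖) := by
        refine add_le_add (Finset.sum_le_sum fun y _ => mul_le_mul_of_nonneg_left (hgy y) (hδhk0 _ _))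
          (Finset.sum_le_sum fun y _ => mul_le_mul_of_nonneg_left ?_ (hk₂0 _ _))
        rw [NegSup.equiv_sub, Pi.sub_apply]; exact hgdy y
    _ = (‖T47 H₁ C₁ εC P₁‖ * ∑ y, δhk b' y * T₁ y + ∑ y, hk₂ b' y * D y) * ‖X‖ := by
        rw [add_mul, Finset.mul_sum, Finset.sum_mul, Finset.sum_mul]
        congr 1 <;> exact Finset.sum_congr rfl fun y _ => by ring

include RC₁ hC₁ RC₂ hC₂ hgC₁0 hCg₁ hG₁ hk₂0 hHk₂ hgC₂0 hCg₂ hG₂ hP₁ hP₂ hδhk0 hδH hδg0 hδg hδG in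
/-- The `r`-weighted column of the entrywise inequality (`r ≥ 0` any fine weight with `Σ_{b′}r(b′)δhk(b′,y) ≤ δΘ^r`, `Σ_{b′}r(b′)hk₂(b′,y) ≤ Θ₂^r`):
`Σ_{b′}r(b′)u(b′,b) ≤ ‖A₁‖δΘ^rG₁(1 + U₁) + Θ₂^r(δG(1 + U₁) + ‖A₂‖G₂U_δ)`, `U₁ = Σ_{b″}u₁(b″,b)`, `U_δ = Σ_{b″}u(b″,b)`.
[cite: Balaban1985Variational, (70)–(71) p.288, Prop. 6 (117) p.295] -/
theorem colSum_weight_kernel_sub_le (bb : Bond d Pd) {r : Bond d Pd → ℝ} (hr : ∀ b', 0 ≤ r b') {δΘr Θ₂r : ℝ} (hδΘr0 : 0 ≤ δΘr) (hΘ₂r0 : 0 ≤ Θ₂r)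
    (hδΘr : ∀ y, ∑ b', r b' * δhk b' y ≤ δΘr) (hΘ₂r : ∀ y, ∑ b', r b' * hk₂ b' y ≤ Θ₂r) :
    ∑ b', r b' * ‖kernel (fderiv ℂ (Emap H₁ C₁ εC) P₁) b' bb - kernel (fderiv ℂ (Emap H₂ C₂' εC) P₂) b' bb‖ ≤
      ‖T47 H₁ C₁ εC P₁‖ * δΘr * G₁ * (1 + ∑ b'', ‖kernel (fderiv ℂ (Emap H₁ C₁ εC) P₁) b'' bb‖) +
      Θ₂r * (δG * (1 + ∑ b'', ‖kernel (fderiv ℂ (Emap H₁ C₁ εC) P₁) b'' bb‖) +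
        ‖T47 H₂ C₂' εC P₂‖ * G₂ * ∑ b'', ‖kernel (fderiv ℂ (Emap H₁ C₁ εC) P₁) b'' bb - kernel (fderiv ℂ (Emap H₂ C₂' εC) P₂) b'' bb‖) := by
  set K₁ := fderiv ℂ (Emap H₁ C₁ εC) P₁ with hK₁
  set K₂ := fderiv ℂ (Emap H₂ C₂' εC) P₂ with hK₂
  set T₁ : β → ℝ := fun y => gC₁ y bb + ∑ b'', gC₁ y b'' * ‖kernel K₁ b'' bb‖ with hT₁
  set D : β → ℝ := fun y => (δg y bb + ∑ b'', δg y b'' * ‖kernel K₁ b'' bb‖) +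
    ‖T47 H₂ C₂' εC P₂‖ * ∑ b'', gC₂ y b'' * ‖kernel K₁ b'' bb - kernel K₂ b'' bb‖ with hD
  set U₁ : ℝ := ∑ b'', ‖kernel K₁ b'' bb‖ with hU₁
  set Uδ : ℝ := ∑ b'', ‖kernel K₁ b'' bb - kernel K₂ b'' bb‖ with hUδ
  have hT₁0 : ∀ y, 0 ≤ T₁ y := fun y => add_nonneg (hgC₁0 _ _) (Finset.sum_nonneg fun _ _ => mul_nonneg (hgC₁0 _ _) (norm_nonneg _))
  have hD0 : ∀ y, 0 ≤ D y := fun y => add_nonneg (add_nonneg (hδg0 _ _) (Finset.sum_nonneg fun _ _ => mul_nonneg (hδg0 _ _) (norm_nonneg _)))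
    (mul_nonneg (norm_nonneg (T47 H₂ C₂' εC P₂)) (Finset.sum_nonneg fun _ _ => mul_nonneg (hgC₂0 _ _) (norm_nonneg _)))
  have hG₁0 : 0 ≤ G₁ := (Finset.sum_nonneg fun y _ => hgC₁0 y bb).trans (hG₁ bb)
  have hG₂0 : 0 ≤ G₂ := (Finset.sum_nonneg fun y _ => hgC₂0 y bb).trans (hG₂ bb)
  have hδG0 : 0 ≤ δG := (Finset.sum_nonneg fun y _ => hδg0 y bb).trans (hδG bb)
  -- `Σ_y T₁(y) ≤ G₁(1 + U₁)`, `Σ_y D(y) ≤ δG(1 + U₁) + ‖A₂‖G₂U_δ`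
  have hTsum : ∑ y, T₁ y ≤ G₁ * (1 + U₁) := by
    simp only [hT₁, Finset.sum_add_distrib]
    rw [Finset.sum_comm, mul_add, mul_one, Finset.mul_sum]
    refine add_le_add (hG₁ bb) (Finset.sum_le_sum fun b'' _ => ?_)
    rw [← Finset.sum_mul]
    exact mul_le_mul_of_nonneg_right (hG₁ b'') (norm_nonneg _)
  have hDsum : ∑ y, D y ≤ δG * (1 + U₁) + ‖T47 H₂ C₂' εC P₂‖ * G₂ * Uδ := by
    simp only [hD, Finset.sum_add_distrib, ← Finset.mul_sum]
    refine add_le_add ?_ ?_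
    · rw [Finset.sum_comm, mul_add, mul_one, Finset.mul_sum]
      refine add_le_add (hδG bb) (Finset.sum_le_sum fun b'' _ => ?_)
      rw [← Finset.sum_mul]
      exact mul_le_mul_of_nonneg_right (hδG b'') (norm_nonneg _)
    · rw [Finset.sum_comm, mul_assoc]
      refine mul_le_mul_of_nonneg_left ?_ (norm_nonneg (T47 H₂ C₂' εC P₂))
      rw [hUδ, Finset.mul_sum]
      refine Finset.sum_le_sum fun b'' _ => ?_
      rw [← Finset.sum_mul]
      exact mul_le_mul_of_nonneg_right (hG₂ b'') (norm_nonneg _)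
  calc ∑ b', r b' * ‖kernel K₁ b' bb - kernel K₂ b' bb‖
      ≤ ∑ b', r b' * (‖T47 H₁ C₁ εC P₁‖ * ∑ y, δhk b' y * T₁ y + ∑ y, hk₂ b' y * D y) := Finset.sum_le_sum fun b' _ =>
        mul_le_mul_of_nonneg_left (opNorm_kernel_sub_le RC₁ hC₁ RC₂ hC₂ hgC₁0 hCg₁ hk₂0 hHk₂ hgC₂0 hCg₂ hP₁ hP₂ hδhk0 hδH hδg0 hδg b' bb) (hr b')
    _ = ‖T47 H₁ C₁ εC P₁‖ * ∑ y, (∑ b', r b' * δhk b' y) * T₁ y + ∑ y, (∑ b', r b' * hk₂ b' y) * D y := by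
        simp only [mul_add, Finset.sum_add_distrib, Finset.mul_sum, Finset.sum_mul]
        rw [Finset.sum_comm]
        congr 1
        · refine Finset.sum_congr rfl fun y _ => Finset.sum_congr rfl fun b' _ => ?_; ring
        · rw [Finset.sum_comm]; refine Finset.sum_congr rfl fun y _ => Finset.sum_congr rfl fun b' _ => ?_; ring
    _ ≤ ‖T47 H₁ C₁ εC P₁‖ * ∑ y, δΘr * T₁ y + ∑ y, Θ₂r * D y :=
        add_le_add (mul_le_mul_of_nonneg_left (Finset.sum_le_sum fun y _ => mul_le_mul_of_nonneg_right (hδΘr y) (hT₁0 y)) (norm_nonneg _))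
          (Finset.sum_le_sum fun y _ => mul_le_mul_of_nonneg_right (hΘ₂r y) (hD0 y))
    _ = ‖T47 H₁ C₁ εC P₁‖ * δΘr * ∑ y, T₁ y + Θ₂r * ∑ y, D y := by rw [← Finset.mul_sum, ← Finset.mul_sum]; ring
    _ ≤ ‖T47 H₁ C₁ εC P₁‖ * δΘr * (G₁ * (1 + U₁)) + Θ₂r * (δG * (1 + U₁) + ‖T47 H₂ C₂' εC P₂‖ * G₂ * Uδ) :=
        add_le_add (mul_le_mul_of_nonneg_left hTsum (mul_nonneg (norm_nonneg _) hδΘr0)) (mul_le_mul_of_nonneg_left hDsum hΘ₂r0)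
    _ = _ := by ring

include RC₁ hC₁ RC₂ hC₂ hk₁0 hHk₁ hH1₁ hgC₁0 hCg₁ hG₁ hq₁ hk₂0 hHk₂ hH1₂ hgC₂0 hCg₂ hG₂ hq₂ hP₁ hP₂ hδhk0 hδH hδg0 hδg hδG in
/-- **THE UNWEIGHTED FINE-COLUMN SUM OF THE KERNEL DIFFERENCE**: `Σ_{b′}u(b′, b) ≤ 4((ε_C + a_C)δΘG₁ + Θ_{H,2}δG)` — the Neumann majorants on both carriers
(`U₁ ≤ 2‖A₁‖Θ_{H,1}G₁ ≤ 1`, `‖A₂‖Θ_{H,2}G₂ ≤ ½` absorbs the recursive term), `Σ_{b′}δhk(b′,y) ≤ δΘ`. [cite: Balaban1985Variational, (70)–(73) pp.288–289, Prop. 6 (117)–(120) p.295] -/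
theorem colSum_kernel_sub_le (hΘH₁ : 0 ≤ ΘH₁) (hΘH₂ : 0 ≤ ΘH₂) {δΘ : ℝ} (hδΘ0 : 0 ≤ δΘ) (hδΘ : ∀ y, ∑ b', δhk b' y ≤ δΘ) (bb : Bond d Pd) :
    ∑ b', ‖kernel (fderiv ℂ (Emap H₁ C₁ εC) P₁) b' bb - kernel (fderiv ℂ (Emap H₂ C₂' εC) P₂) b' bb‖ ≤ 4 * ((εC + aC) * δΘ * G₁ + ΘH₂ * δG) := by
  have hG₁0 : 0 ≤ G₁ := (Finset.sum_nonneg fun y _ => hgC₁0 y bb).trans (hG₁ bb)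
  have hG₂0 : 0 ≤ G₂ := (Finset.sum_nonneg fun y _ => hgC₂0 y bb).trans (hG₂ bb)
  have hδG0 : 0 ≤ δG := (Finset.sum_nonneg fun y _ => hδg0 y bb).trans (hδG bb)
  have hA₁ : ‖T47 H₁ C₁ εC P₁‖ ≤ εC + aC := (norm_T47_lt RC₁ hP₁).le
  have hA₂ : ‖T47 H₂ C₂' εC P₂‖ ≤ εC + aC := (norm_T47_lt RC₂ hP₂).le
  -- `U₁ ≤ 1`
  have hU1 : ∑ b'', ‖kernel (fderiv ℂ (Emap H₁ C₁ εC) P₁) b'' bb‖ ≤ 1 := by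
    have h := colSum_kernel_fderiv_Emap_le RC₁ hC₁ hk₁0 hHk₁ hH1₁ hgC₁0 hCg₁ hG₁ hq₁ hΘH₁ hP₁ bb
    have hq1 : ‖T47 H₁ C₁ εC P₁‖ * ΘH₁ * G₁ ≤ 1 / 2 := (mul_le_mul_of_nonneg_right (mul_le_mul_of_nonneg_right hA₁ hΘH₁) hG₁0).trans hq₁
    linarith
  have h := colSum_weight_kernel_sub_le RC₁ hC₁ RC₂ hC₂ hgC₁0 hCg₁ hG₁ hk₂0 hHk₂ hgC₂0 hCg₂ hG₂ hP₁ hP₂ hδhk0 hδH hδg0 hδg hδG bb (r := fun _ => 1)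
    (fun _ => zero_le_one) hδΘ0 hΘH₂ (fun y => by simpa only [one_mul] using hδΘ y) (fun y => by simpa only [one_mul] using hH1₂ y)
  simp only [one_mul] at h
  obtain ⟨Uδ, hUδ⟩ : ∃ U : ℝ, U = ∑ b', ‖kernel (fderiv ℂ (Emap H₁ C₁ εC) P₁) b' bb - kernel (fderiv ℂ (Emap H₂ C₂' εC) P₂) b' bb‖ := ⟨_, rfl⟩
  have hUδ0 : 0 ≤ Uδ := by rw [hUδ]; exact Finset.sum_nonneg fun _ _ => norm_nonneg _
  rw [← hUδ] at h ⊢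
  have hs0 : 0 ≤ εC + aC := (norm_nonneg _).trans hA₁
  -- `Uδ ≤ X + q₂Uδ`, `q₂ ≤ ½`
  have hq2 : ‖T47 H₂ C₂' εC P₂‖ * ΘH₂ * G₂ ≤ 1 / 2 := (mul_le_mul_of_nonneg_right (mul_le_mul_of_nonneg_right hA₂ hΘH₂) hG₂0).trans hq₂
  have hU0 : 0 ≤ ∑ b'', ‖kernel (fderiv ℂ (Emap H₁ C₁ εC) P₁) b'' bb‖ := Finset.sum_nonneg fun _ _ => norm_nonneg _
  have h1 : ‖T47 H₁ C₁ εC P₁‖ * δΘ * G₁ * (1 + ∑ b'', ‖kernel (fderiv ℂ (Emap H₁ C₁ εC) P₁) b'' bb‖) ≤ (εC + aC) * δΘ * G₁ * 2 :=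
    mul_le_mul (mul_le_mul_of_nonneg_right (mul_le_mul_of_nonneg_right hA₁ hδΘ0) hG₁0) (by linarith) (by linarith)
      (mul_nonneg (mul_nonneg hs0 hδΘ0) hG₁0)
  have h2 : δG * (1 + ∑ b'', ‖kernel (fderiv ℂ (Emap H₁ C₁ εC) P₁) b'' bb‖) ≤ δG * 2 := mul_le_mul_of_nonneg_left (by linarith) hδG0
  have h3 : ΘH₂ * (‖T47 H₂ C₂' εC P₂‖ * G₂ * Uδ) ≤ 1 / 2 * Uδ := by
    calc ΘH₂ * (‖T47 H₂ C₂' εC P₂‖ * G₂ * Uδ) = ‖T47 H₂ C₂' εC P₂‖ * ΘH₂ * G₂ * Uδ := by ring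
      _ ≤ 1 / 2 * Uδ := mul_le_mul_of_nonneg_right hq2 hUδ0
  nlinarith [h, h1, h2, h3, mul_nonneg hΘH₂ hδG0]

include RC₁ hC₁ RC₂ hC₂ hk₁0 hHk₁ hH1₁ hgC₁0 hCg₁ hG₁ hq₁ hk₂0 hHk₂ hH1₂ hgC₂0 hCg₂ hG₂ hq₂ hP₁ hP₂ hδhk0 hδH hδg0 hδg hδG in
/-- **THE WEIGHTED FINE-COLUMN LETTER `δθ_E` OF THE KERNEL DIFFERENCE** — the binder `hδΘE` of `B11Eq98W80TwoBackgroundLetters.norm_W80_sub_W80_le_pair`: for a fine weight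
`r ≥ 0` with `Σ_{b′}r(b′)δhk(b′,y) ≤ δΘ^r`, `Σ_{b′}r(b′)hk₂(b′,y) ≤ Θ₂^r`,
`Σ_{b′}r(b′)u(b′,b) ≤ 2(ε_C + a_C)δΘ^rG₁ + Θ₂^r(2δG + 4(ε_C + a_C)G₂((ε_C + a_C)δΘG₁ + Θ_{H,2}δG))` — linear in the two-background letters `δΘ, δΘ^r, δG`.
[cite: Balaban1985Variational, (73) p.289, (86)–(89) p.291, Prop. 6 (117)–(120) p.295] -/
theorem colSum_weighted_kernel_sub_le (hΘH₁ : 0 ≤ ΘH₁) (hΘH₂ : 0 ≤ ΘH₂) {δΘ : ℝ} (hδΘ0 : 0 ≤ δΘ) (hδΘ : ∀ y, ∑ b', δhk b' y ≤ δΘ)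
    (bb : Bond d Pd) {r : Bond d Pd → ℝ} (hr : ∀ b', 0 ≤ r b') {δΘr Θ₂r : ℝ} (hδΘr0 : 0 ≤ δΘr) (hΘ₂r0 : 0 ≤ Θ₂r)
    (hδΘr : ∀ y, ∑ b', r b' * δhk b' y ≤ δΘr) (hΘ₂r : ∀ y, ∑ b', r b' * hk₂ b' y ≤ Θ₂r) :
    ∑ b', r b' * ‖kernel (fderiv ℂ (Emap H₁ C₁ εC) P₁) b' bb - kernel (fderiv ℂ (Emap H₂ C₂' εC) P₂) b' bb‖ ≤
      2 * (εC + aC) * δΘr * G₁ + Θ₂r * (2 * δG + 4 * (εC + aC) * G₂ * ((εC + aC) * δΘ * G₁ + ΘH₂ * δG)) := by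
  have hG₁0 : 0 ≤ G₁ := (Finset.sum_nonneg fun y _ => hgC₁0 y bb).trans (hG₁ bb)
  have hG₂0 : 0 ≤ G₂ := (Finset.sum_nonneg fun y _ => hgC₂0 y bb).trans (hG₂ bb)
  have hδG0 : 0 ≤ δG := (Finset.sum_nonneg fun y _ => hδg0 y bb).trans (hδG bb)
  have hA₁ : ‖T47 H₁ C₁ εC P₁‖ ≤ εC + aC := (norm_T47_lt RC₁ hP₁).le
  have hA₂ : ‖T47 H₂ C₂' εC P₂‖ ≤ εC + aC := (norm_T47_lt RC₂ hP₂).le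
  have hU1 : ∑ b'', ‖kernel (fderiv ℂ (Emap H₁ C₁ εC) P₁) b'' bb‖ ≤ 1 := by
    have h := colSum_kernel_fderiv_Emap_le RC₁ hC₁ hk₁0 hHk₁ hH1₁ hgC₁0 hCg₁ hG₁ hq₁ hΘH₁ hP₁ bb
    have hq1 : ‖T47 H₁ C₁ εC P₁‖ * ΘH₁ * G₁ ≤ 1 / 2 := (mul_le_mul_of_nonneg_right (mul_le_mul_of_nonneg_right hA₁ hΘH₁) hG₁0).trans hq₁
    linarith
  have hU0 : 0 ≤ ∑ b'', ‖kernel (fderiv ℂ (Emap H₁ C₁ εC) P₁) b'' bb‖ := Finset.sum_nonneg fun _ _ => norm_nonneg _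
  have hs0 : 0 ≤ εC + aC := (norm_nonneg _).trans hA₁
  have hUδ := colSum_kernel_sub_le RC₁ hC₁ RC₂ hC₂ hk₁0 hHk₁ hH1₁ hgC₁0 hCg₁ hG₁ hq₁ hk₂0 hHk₂ hH1₂ hgC₂0 hCg₂ hG₂ hq₂ hP₁ hP₂ hδhk0 hδH hδg0 hδg hδG
    hΘH₁ hΘH₂ hδΘ0 hδΘ bb
  have h := colSum_weight_kernel_sub_le RC₁ hC₁ RC₂ hC₂ hgC₁0 hCg₁ hG₁ hk₂0 hHk₂ hgC₂0 hCg₂ hG₂ hP₁ hP₂ hδhk0 hδH hδg0 hδg hδG bb hr hδΘr0 hΘ₂r0 hδΘr hΘ₂r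
  refine h.trans ?_
  have h1 : ‖T47 H₁ C₁ εC P₁‖ * δΘr * G₁ * (1 + ∑ b'', ‖kernel (fderiv ℂ (Emap H₁ C₁ εC) P₁) b'' bb‖) ≤ (εC + aC) * δΘr * G₁ * 2 :=
    mul_le_mul (mul_le_mul_of_nonneg_right (mul_le_mul_of_nonneg_right hA₁ hδΘr0) hG₁0) (by linarith) (by linarith)
      (mul_nonneg (mul_nonneg hs0 hδΘr0) hG₁0)
  have h2 : δG * (1 + ∑ b'', ‖kernel (fderiv ℂ (Emap H₁ C₁ εC) P₁) b'' bb‖) ≤ δG * 2 := mul_le_mul_of_nonneg_left (by linarith) hδG0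
  have h3 : ‖T47 H₂ C₂' εC P₂‖ * G₂ * ∑ b'', ‖kernel (fderiv ℂ (Emap H₁ C₁ εC) P₁) b'' bb - kernel (fderiv ℂ (Emap H₂ C₂' εC) P₂) b'' bb‖ ≤
      (εC + aC) * G₂ * (4 * ((εC + aC) * δΘ * G₁ + ΘH₂ * δG)) :=
    mul_le_mul (mul_le_mul_of_nonneg_right hA₂ hG₂0) hUδ (Finset.sum_nonneg fun _ _ => norm_nonneg _) (mul_nonneg hs0 hG₂0)
  nlinarith [h1, h2, h3, hΘ₂r0, mul_le_mul_of_nonneg_left (add_le_add h2 h3) hΘ₂r0]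

end Literature.MathematicalPhysics.QuantumFieldTheory.Balaban1983to89.B11Eq73KernelColumnsTwoBackgrounds

end
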